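import Summits.Ventures.Crystal3D.Bulk.GapVertexStarBounds
import HarnessLib

/-!
# The vertex LP block from the census socket alone: `CensusRows c` ⇒ at every vertex the gaps
# are `< π`, equal the corners, sum to `2π`, with `3 ≤ d ≤ 5` (`≤ 4` at the hole above `1.0515`)

HONEST FRAMING. Part of the venture `Summits/Ventures/Crystal3D` (cell `pub-crystal3d`, phase 2,
24-hour sprint `PLAN.md` R42/R43; seat typer-bulk-2). The census socket of
`Bulk/GapCensusRows.lean` asks the engines to kill every configuration `c` with `CensusRows c`
(and intruder distance in the window). The vertex-star rows of `Bulk/GapVertexStarBounds.lean`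
were stated for REDUCED EXTREMAL configurations; this file derives them from the FIELDS of
`CensusRows c` alone (admissibility, the window, P-L2(a) at shell balls and at the hole, the
degree rows), so that a kill may use them under the socket's hypothesis:

* `IsGapConfig.tightGap_lt_pi_of_noHalfPlane` — every gap at a vertex is `< π` as soon as the
  tight partners of that vertex lie in no closed tangent half-plane (the P-L2(a) field shape);
* `CensusRows.tightGap_lt_pi` (any vertex `i ≠ 0`), `CensusRows.card_tightAngles`,
  **`CensusRows.vertexBlock`** (shell ball with a tight partner: `3 ≤ d ≤ 5` gaps, each `< π` and
  equal to the corner between consecutive partners, `Σ = 2π`) and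
  **`CensusRows.vertexBlock_intruder`** (the hole: `3 ≤ d ≤ 5`, `d ≤ 4` when `1.0515 ≤ D`, same
  gap facts).

Nothing is claimed about GAP(1.26).
-/

noncomputable section

open scoped BigOperators InnerProductSpace
open Finset Real

namespace Summit.Ventures.Crystal3D

open Literature.Geometry.DiscreteGeometry

variable {c : Fin 14 → EuclideanSpace ℝ (Fin 3)}

/-- **Gap `< π` from the no-half-plane property at a vertex.** For an admissible configuration
and a ball `i ≠ 0` whose tight partners lie in no closed tangent half-plane at `c i − c 0` (for
every nonzero tangent `n` some tight partner `j` has `⟪n, c j − c 0⟫ > 0`), every gap around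
`i` is `< π`. -/
theorem IsGapConfig.tightGap_lt_pi_of_noHalfPlane (hc : IsGapConfig c) {i : Fin 14} (hi0 : i ≠ 0)
    (hP : ∀ n : EuclideanSpace ℝ (Fin 3), n ≠ 0 → ⟪c i - c 0, n⟫_ℝ = 0 →
      ∃ j : Fin 14, j ≠ 0 ∧ j ≠ i ∧ dist (c i) (c j) = 1 ∧ 0 < ⟪n, c j - c 0⟫_ℝ)
    {k : ℕ} (hd : (tightAngles c i).card = k + 1) (m : Fin (k + 1)) : tightGap c i hd m < π := by
  by_contra hge
  push Not at hge
  set φ := sortedTightAngle c i hd m + tightGap c i hd m / 2 with hφ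
  have hnt : ⟪c i - c 0, tangentDir (gapDir c i) (hc.norm_gapDir hi0) φ⟫_ℝ = 0 := by
    rw [hc.sub_eq_norm_smul_gapDir hi0, real_inner_smul_left]
    exact mul_eq_zero_of_right _ (inner_tangentDir_self φ)
  obtain ⟨j, hj0, hji, hdij, hpos⟩ := hP _ (tangentDir_ne_zero φ) hnt
  have hle := hc.inner_tangentDir_nonpos_of_pi_le_tightGap hi0 hd m hge
    (mem_tightNbrs.2 ⟨hj0, hji, hdij⟩)
  exact absurd hle (not_le.2 hpos)

/-- Window arithmetic: `CensusRows c` gives `intruderDist² < 3`, `< 12/7` and `intruderDist < 2`. -/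
theorem CensusRows.intruderDist_bounds (h : CensusRows c) :
    intruderDist c ^ 2 < 3 ∧ intruderDist c ^ 2 < 12 / 7 ∧ intruderDist c < 2 := by
  have h1 := h.one_lt_intruderDist
  have h2 := h.intruderDist_le
  refine ⟨by nlinarith, by nlinarith, by linarith⟩

/-- Under the socket hypothesis the azimuths of the tight partners are distinct:
`#tightAngles = #tightNbrs`. -/
theorem CensusRows.card_tightAngles (h : CensusRows c) {i : Fin 14} (hi0 : i ≠ 0) :
    (tightAngles c i).card = (tightNbrs c i).card :=
  h.isGapConfig.card_tightAngles h.intruderDist_bounds.1 hi0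

/-- **Every gap is `< π` under the socket hypothesis**, at every vertex `i ≠ 0` (shell ball or
hole) with at least one tight partner. -/
theorem CensusRows.tightGap_lt_pi (h : CensusRows c) {i : Fin 14} (hi0 : i ≠ 0) {k : ℕ}
    (hd : (tightAngles c i).card = k + 1) (m : Fin (k + 1)) : tightGap c i hd m < π := by
  by_cases hi13 : i = 13
  · subst hi13
    exact h.isGapConfig.tightGap_lt_pi_of_noHalfPlane hi0 h.exists_inner_pos_intruder hd m
  · have htight : ∃ j : Fin 14, j ≠ 0 ∧ j ≠ i ∧ dist (c i) (c j) = 1 :=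
      ⟨tightNbrAt c i hd m, mem_tightNbrs.1 (tightNbrAt_mem c i hd m)⟩
    exact h.isGapConfig.tightGap_lt_pi_of_noHalfPlane hi0
      (h.exists_inner_pos_shell i hi0 hi13 htight) hd m

/-- **The vertex LP block at a shell ball, from the socket hypothesis.** If `CensusRows c` and the
shell ball `i` has `k + 1 ≥ 1` tight partners (as counted by their azimuths), then
`3 ≤ k + 1 ≤ 5`, every gap is `< π` and equals the corner between its consecutive partners
(rows R-min / R-tri of `Bulk/GapCorners.lean` apply), and the gaps sum to `2π` (R-sum). -/
theorem CensusRows.vertexBlock (h : CensusRows c) {i : Fin 14} (hi0 : i ≠ 0) (hi13 : i ≠ 13)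
    {k : ℕ} (hd : (tightAngles c i).card = k + 1) :
    (3 ≤ k + 1 ∧ k + 1 ≤ 5) ∧
      (∀ m, tightGap c i hd m < π ∧
        tightGap c i hd m =
          corner c i (tightNbrAt c i hd (finRotate (k + 1) m)) (tightNbrAt c i hd m)) ∧
      ∑ m, tightGap c i hd m = 2 * π := by
  obtain ⟨hD3, -, -⟩ := h.intruderDist_bounds
  have hcard : (tightNbrs c i).card = k + 1 := by rw [← h.card_tightAngles hi0]; exact hd
  have htight : ∃ j : Fin 14, j ≠ 0 ∧ j ≠ i ∧ dist (c i) (c j) = 1 :=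
    ⟨tightNbrAt c i hd 0, mem_tightNbrs.1 (tightNbrAt_mem c i hd 0)⟩
  have h3 := h.three_le_card_tight i hi0 hi13 htight
  have h5 := h.card_tight_le_five i hi0 hi13
  have hset : (univ.filter fun j : Fin 14 => j ≠ 0 ∧ j ≠ i ∧ dist (c i) (c j) = 1) =
      tightNbrs c i := rfl
  rw [hset, hcard] at h3 h5
  refine ⟨⟨h3, h5⟩, fun m => ⟨h.tightGap_lt_pi hi0 hd m, ?_⟩, sum_tightGap c i hd⟩
  exact h.isGapConfig.tightGap_eq_corner hD3 hi0 hd m (h.tightGap_lt_pi hi0 hd m).le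

/-- **The vertex LP block at the hole, from the socket hypothesis**: `3 ≤ d ≤ 5` hole contacts,
`d ≤ 4` when `1.0515 ≤ intruderDist c`, every gap `< π` and equal to the corner between its
consecutive contacts (R-min there: `≥ A_p(ρ)`), gaps summing to `2π`. -/
theorem CensusRows.vertexBlock_intruder (h : CensusRows c) {k : ℕ}
    (hd : (tightAngles c 13).card = k + 1) :
    (3 ≤ k + 1 ∧ k + 1 ≤ 5 ∧ ((1.0515 : ℝ) ≤ intruderDist c → k + 1 ≤ 4)) ∧
      (∀ m, tightGap c 13 hd m < π ∧
        tightGap c 13 hd m =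
          corner c 13 (tightNbrAt c 13 hd (finRotate (k + 1) m)) (tightNbrAt c 13 hd m)) ∧
      ∑ m, tightGap c 13 hd m = 2 * π := by
  obtain ⟨hD3, -, -⟩ := h.intruderDist_bounds
  have h13 : (13 : Fin 14) ≠ 0 := by decide
  have hcard : (tightNbrs c 13).card = k + 1 := by rw [← h.card_tightAngles h13]; exact hd
  have h3 := h.three_le_card_intruderContacts
  have h5 := h.card_intruderContacts_le_five
  have h4 := h.card_intruderContacts_le_four
  have hset : (univ.filter fun j : Fin 14 => j ≠ 0 ∧ j ≠ 13 ∧ dist (c 13) (c j) = 1) =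
      tightNbrs c 13 := rfl
  rw [hset, hcard] at h3 h5 h4
  refine ⟨⟨h3, h5, h4⟩, fun m => ⟨h.tightGap_lt_pi h13 hd m, ?_⟩, sum_tightGap c 13 hd⟩
  exact h.isGapConfig.tightGap_eq_corner hD3 h13 hd m (h.tightGap_lt_pi h13 hd m).le

end Summit.Ventures.Crystal3D
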